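import Mathlib
import HarnessLib
import Literature.NumberTheory.GaloisRepresentations.ProjectiveType
import Literature.NumberTheory.GaloisRepresentations.SerreProp16PGL2Cor
import Summits.Langlands.Langlands.Theorems.NonParallelVoidTensorSquareParallelStubEnormousResidualPackageScalarElement

/-!
# Stub `stub_qianPackage_of_primeToP` of line `potaut` for crux `LocallyReducibleParallel`
# (stmt-Langlands-17002) — helper: a scalar `ρ̄(σ)` with `σ ∉ Γ_{F(ζ_p)}` (Qian 2023, Thm. 1.4 (iv))
# for every non-cyclic projective image of order prime to `p`

Crux `stmt-Langlands-17002` = `Summit.Langlands.Langlands.Theses.NonParallelVoid.LocallyReducibleParallel`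
(line `potaut`, stub `stub_qianPackage_of_primeToP`: hypotheses (iii)–(iv) of Qian 2023 Thm. 1.4
for `ρ̄ = ρ.residualRep`, `F` imaginary quadratic, `p ≥ 11`, when `ρ̄|_{Γ_{F(ζ_p)}}` is absolutely
irreducible with projective image of order prime to `p`).  The sibling crux `TensorSquareParallel`
landed hypothesis (iv), "there exists `σ ∈ G_F − G_{F(ζ_l)}` such that `r̄(σ)` is a scalar", in the
projectively DIHEDRAL corner (`exists_not_mem_scalar_of_isDihedralType`, file
`…StubEnormousResidualPackageScalarElement`).  This file PROVES it (no named fact) for EVERY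
`τ : Γ_F →* GL₂(k)`, `char k = p`, `[F : ℚ] = 2`, `p ≥ 11`, whose restriction to `Γ_{F(ζ_p)}` has
finite, NON-CYCLIC projective image of order prime to `p` — so also for the primitive types
`𝔄₄`, `𝔖₄`, `𝔄₅`:

* §1 `isCyclic_of_card_le_three`, `false_of_not_isCyclic_ker` — group theory: a finite
  `Q ≤ PGL₂(k)` of order prime to `p` admits no homomorphism to a commutative group with
  non-cyclic kernel and cyclic image of order `≥ 4`.  By Serre 1972, Prop. 16 (tree
  `Serre1972.prop16_card`) `Q` is cyclic (then so is the kernel), dihedral or `≅ 𝔖₄` (homomorphisms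
  to commutative groups kill squares, sibling's `map_dihedral_sq_eq_one` / `map_perm_sq_eq_one`, so
  a cyclic image has order `≤ 2`), of order `12` (but a non-cyclic kernel has order `≥ 4`, so
  `|Q| ≥ 16`), or `≅ 𝔄₅` (simple).
* §2 `exists_not_mem_scalar_of_not_isCyclic` — the Galois side, verbatim from the sibling:
  `Γ_{F(ζ_p)} = ker(χ_p ∘ res)` with cyclic image of order `≥ (p-1)/2 ≥ 5`; if no
  `σ ∉ Γ_{F(ζ_p)}` had `τ(σ)` scalar, `χ_p ∘ res` would factor through `Proj τ(Γ_F) ≤ PGL₂(k)`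
  with kernel `Proj τ(Γ_{F(ζ_p)})`, contradicting §1.

## References

* [Qian2022] L. Qian, *Potential automorphy for `GL_n`*, Invent. Math. 231 (2023), Thm. 1.4 (iv).
* [Serre1972] J.-P. Serre, *Propriétés galoisiennes des points d'ordre fini des courbes
  elliptiques*, Invent. Math. 15 (1972), §2.5, Prop. 16 (through the tree).
* [ACCGHLNSTT2023] P. B. Allen et al., *Potential automorphy over CM fields*, Ann. of Math. 197
  (2023), Rem. 6.1.4 (the role of the scalar element).
-/

set_option linter.dupNamespace false

noncomputable section

namespace Summit.Langlands.Langlands.Cruxes.LocallyReducibleParallel.Potaut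

open scoped MatrixGroups
open Field Literature.NumberTheory.GaloisRepresentations
open Summit.Langlands.Langlands.Theorems.TensorSquareParallel

/-! ## §1. Group theory: no cyclic "extension" of order `≥ 4` of a non-cyclic group in `PGL₂(k)` -/
section GroupTheory

/-- A finite group of order at most `3` is cyclic (orders `1`, `2`, `3`). [folklore] -/
theorem isCyclic_of_card_le_three {K : Type*} [Group K] [Finite K] (h : Nat.card K ≤ 3) :
    IsCyclic K := by
  have hpos : 0 < Nat.card K := Nat.card_pos
  interval_cases hK : Nat.card K
  · haveI : Subsingleton K := (Nat.card_eq_one_iff_unique.1 hK).1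
    exact isCyclic_of_subsingleton
  · haveI : Fact (Nat.Prime 2) := ⟨Nat.prime_two⟩
    exact isCyclic_of_prime_card hK
  · haveI : Fact (Nat.Prime 3) := ⟨Nat.prime_three⟩
    exact isCyclic_of_prime_card hK

/-- **No finite subgroup `Q ≤ PGL₂(k)` of order prime to `p = char k` is an extension of a cyclic
group of order `≥ 4` by a NON-CYCLIC group.**  By Serre 1972 Prop. 16 (tree
`Serre1972.prop16_card`) `Q` is cyclic (but the kernel is not), dihedral or `≅ 𝔖₄` (every
homomorphism to a commutative group kills squares, so a cyclic quotient has order `≤ 2`), of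
order `12` (but `|Q| = |ker| · |im| ≥ 4 · 4`), or `≅ 𝔄₅` (simple: the kernel is trivial or
everything).  Generalises the sibling's `false_of_ker_equiv_dihedral` (kernel `≅ D_m`, `m ≥ 2`)
to the kernels `𝔄₄`, `𝔖₄`, `𝔄₅`. [cite: Serre1972, §2.5, Prop. 16] -/
theorem false_of_not_isCyclic_ker {k : Type*} [Field k] {p : ℕ} [Fact p.Prime] [CharP k p]
    {Q : Subgroup PGL(Fin 2, k)} {C : Type*} [CommGroup C] (f : Q →* C)
    [Finite f.ker] [Finite f.range] [IsCyclic f.range]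
    (hker : ¬ p ∣ Nat.card f.ker) (hran : ¬ p ∣ Nat.card f.range)
    (hnc : ¬ IsCyclic f.ker) (h4 : 4 ≤ Nat.card f.range) : False := by
  -- adapted from `Summit.Langlands.Langlands.Theorems.TensorSquareParallel.false_of_ker_equiv_dihedral`
  have hp : p.Prime := Fact.out
  have hker4 : 4 ≤ Nat.card f.ker := by
    by_contra h
    exact hnc (isCyclic_of_card_le_three (by omega))
  -- `|Q| = |ker f| · |range f|`
  have hmul : Nat.card f.ker * Nat.card f.range = Nat.card Q := by
    rw [← Subgroup.index_ker, Subgroup.card_mul_index]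
  have hQ0 : Nat.card Q ≠ 0 := by
    rw [← hmul]; exact mul_ne_zero (by omega) (by omega)
  haveI : Finite Q := Nat.finite_of_card_ne_zero hQ0
  have hQk : ((Nat.card Q : ℕ) : k) ≠ 0 := by
    rw [Ne, CharP.cast_eq_zero_iff k p, ← hmul]
    intro h
    rcases (Nat.Prime.dvd_mul hp).1 h with h | h
    exacts [hker h, hran h]
  -- if `f` kills all squares then `|range f| ≤ 2`
  have key : (∀ x : Q, f x ^ 2 = 1) → False := fun hall ↦ by
    obtain ⟨g, hg⟩ := IsCyclic.exists_ofOrder_eq_natCard (α := f.range)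
    obtain ⟨x, hx⟩ := MonoidHom.mem_range.1 g.2
    have h1 : (g : C) ^ 2 = 1 := by rw [← hx]; exact hall x
    have h2 : orderOf g ≤ 2 := by
      rw [← Subgroup.orderOf_coe]
      exact orderOf_le_of_pow_eq_one (by norm_num) h1
    omega
  rcases Serre1972.prop16_card Q hQk with hcyc | ⟨n, ⟨eD⟩⟩ | ⟨h12, -⟩ | ⟨-, ⟨eS⟩⟩ | ⟨-, ⟨eA⟩⟩
  · -- cyclic `Q`: then `ker f` is cyclic
    haveI := hcyc
    exact hnc (Subgroup.isCyclic f.ker)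
  · -- dihedral `Q`
    refine key fun x ↦ ?_
    have := map_dihedral_sq_eq_one (f.comp eD.symm.toMonoidHom) (eD x)
    simpa using this
  · -- `|Q| = 12`
    have : 16 ≤ Nat.card Q := by
      rw [← hmul]
      calc 16 = 4 * 4 := by norm_num
        _ ≤ Nat.card f.ker * Nat.card f.range := Nat.mul_le_mul hker4 h4
    omega
  · -- `Q ≅ 𝔖₄`
    refine key fun x ↦ ?_
    have := map_perm_sq_eq_one (f.comp eS.symm.toMonoidHom) (eS x)
    simpa using this
  · -- `Q ≅ 𝔄₅` is simple
    haveI : IsSimpleGroup Q := eA.isSimpleGroup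
    rcases (MonoidHom.normal_ker f).eq_bot_or_eq_top with h | h
    · rw [h, Subgroup.card_bot] at hker4; omega
    · have : Nat.card f.range = 1 := by rw [← Subgroup.index_ker, h, Subgroup.index_top]
      omega

end GroupTheory

/-! ## §2. The scalar element -/
section Galois

variable (p : ℕ) [Fact p.Prime] (F : Type) [Field F] [NumberField F]

/-- **A scalar `τ(σ)` off `Γ_{F(ζ_p)}`** (hypothesis (iv) of Qian 2023, Thm. 1.4) for every
non-cyclic prime-to-`p` projective image.  Let `[F : ℚ] = 2`, `p ≥ 11`, `k` of characteristic
`p`, and `τ : Γ_F →* GL₂(k)` whose restriction to `Γ_{F(ζ_p)}` has finite, non-cyclic projective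
image of order prime to `p`.  Then some `σ ∈ Γ_F ∖ Γ_{F(ζ_p)}` has `τ(σ)` scalar: `Γ_{F(ζ_p)}` is
the kernel of `ψ = χ_p ∘ res : Γ_F → (ℤ/p)ˣ`, whose image is cyclic of order `≥ (p-1)/2 ≥ 5`; if
no `σ ∉ Γ_{F(ζ_p)}` had `τ(σ)` scalar, `ψ` would factor through `f : Proj τ(Γ_F) → (ℤ/p)ˣ` with
`ker f ≅ Proj τ(Γ_{F(ζ_p)})` non-cyclic, contradicting `false_of_not_isCyclic_ker`.  The proof is
the sibling's `exists_not_mem_scalar_of_isDihedralType` verbatim up to the last line.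
[cite: Qian2022, Thm. 1.4 (hypothesis (iv))] -/
theorem exists_not_mem_scalar_of_not_isCyclic (hF2 : Module.finrank ℚ F = 2) (hp11 : 11 ≤ p)
    {k : Type} [Field k] [CharP k p] (τ : absoluteGaloisGroup F →* GL (Fin 2) k)
    [Finite (projectiveImage (τ.comp (absGaloisGroupAdjoinRootsOfUnity F p).subtype))]
    (hcop : ¬ p ∣ Nat.card (projectiveImage (τ.comp (absGaloisGroupAdjoinRootsOfUnity F p).subtype)))
    (hnc : ¬ IsCyclic (projectiveImage (τ.comp (absGaloisGroupAdjoinRootsOfUnity F p).subtype))) :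
    ∃ σ : absoluteGaloisGroup F, σ ∉ absGaloisGroupAdjoinRootsOfUnity F p ∧
      ∃ c : k, ((τ σ : GL (Fin 2) k) : Matrix (Fin 2) (Fin 2) k) =
        c • (1 : Matrix (Fin 2) (Fin 2) k) := by
  -- adapted from `Summit.Langlands.Langlands.Theorems.TensorSquareParallel.exists_not_mem_scalar_of_isDihedralType`
  classical
  have hpp : p.Prime := Fact.out
  haveI : NeZero ((p : ℕ) : ℚ) := NeZero.charZero
  haveI : Algebra.IsQuadraticExtension ℚ F := ⟨hF2⟩
  set Γ₁ := absGaloisGroupAdjoinRootsOfUnity F p with hΓ₁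
  -- the character `ψ = χ_p ∘ res`, with kernel `Γ₁`
  set χ := modNCyclotomicCharacter ℚ p with hχ
  set ψ : absoluteGaloisGroup F →* (ZMod p)ˣ := χ.comp (absGaloisRestrict ℚ F).toMonoidHom with hψ
  have hψker : ∀ σ, ψ σ = 1 ↔ σ ∈ Γ₁ := fun σ ↦ by
    rw [hΓ₁, mem_absGaloisGroupAdjoinRootsOfUnity_iff_absGaloisRestrict ℚ F p σ,
      Rat.mem_absGaloisGroupAdjoinRootsOfUnity_iff_modNCyclotomicCharacter]
    rfl
  -- `|ψ(Γ_F)| ≥ (p - 1)/2 ≥ 5`, prime to `p`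
  have hHi : ((absGaloisRestrict ℚ F).range : Subgroup (absoluteGaloisGroup ℚ)).index = 2 :=
    (SorensenPatching.index_range_absGaloisRestrict ℚ F).trans hF2
  have hrange : ψ.range = ((absGaloisRestrict ℚ F).range : Subgroup (absoluteGaloisGroup ℚ)).map χ :=
    MonoidHom.range_comp _ _
  have hidx : ψ.range.index ∣ 2 := by
    rw [hrange, ← hHi]
    exact Subgroup.index_map_dvd _ (Rat.modNCyclotomicCharacter_surjective p)
  have hcardU : Nat.card (ZMod p)ˣ = p - 1 := by rw [Nat.card_eq_fintype_card, ZMod.card_units]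
  have h5 : 5 ≤ Nat.card ψ.range := by
    have h1 := ψ.range.card_mul_index
    rw [hcardU] at h1
    have h2 : ψ.range.index ≤ 2 := Nat.le_of_dvd two_pos hidx
    have h3 : p - 1 ≤ Nat.card ψ.range * 2 := by
      rw [← h1]; exact Nat.mul_le_mul_left _ h2
    omega
  have hranψ : ¬ p ∣ Nat.card ψ.range := fun h ↦ by
    have h1 : Nat.card ψ.range ∣ p - 1 := by
      rw [← hcardU]; exact Subgroup.card_subgroup_dvd_card ψ.range
    have := Nat.le_of_dvd (by omega) (h.trans h1)
    omega
  -- suppose no `σ ∉ Γ₁` has `τ σ` scalar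
  by_contra hcon
  push Not at hcon
  set P : absoluteGaloisGroup F →* PGL(Fin 2, k) := Matrix.ProjGenLinGroup.mk.comp τ with hP
  have hkerP : ∀ σ, P σ = 1 → σ ∈ Γ₁ := by
    intro σ hσ
    by_contra hσ1
    rw [hP, MonoidHom.comp_apply, Matrix.ProjGenLinGroup.mk_eq_one,
      Matrix.GeneralLinearGroup.center_eq_range_scalar] at hσ
    obtain ⟨u, hu⟩ := hσ
    refine hcon σ hσ1 (u : k) ?_
    rw [← hu, Matrix.GeneralLinearGroup.coe_scalar, Matrix.scalar_apply,
      Matrix.smul_one_eq_diagonal]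
  -- `ψ` factors through `P(Γ_F)`: `f ∘ π = ψ`
  set π := P.rangeRestrict with hπ
  have hπsurj : Function.Surjective π := MonoidHom.rangeRestrict_surjective P
  have hle : π.ker ≤ ψ.ker := fun σ hσ ↦ by
    rw [MonoidHom.mem_ker] at hσ ⊢
    rw [hψker]
    exact hkerP σ (congrArg Subtype.val hσ)
  set f : P.range →* (ZMod p)ˣ := π.liftOfSurjective hπsurj ⟨ψ, hle⟩ with hf
  have hfπ : ∀ σ, f (π σ) = ψ σ := fun σ ↦ π.liftOfRightInverse_comp_apply _ _ ⟨ψ, hle⟩ σ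
  have hfran : f.range = ψ.range := by
    ext y
    constructor
    · rintro ⟨x, rfl⟩
      obtain ⟨σ, rfl⟩ := hπsurj x
      exact ⟨σ, (hfπ σ).symm⟩
    · rintro ⟨σ, rfl⟩
      exact ⟨π σ, hfπ σ⟩
  -- `ker f ≅ P(Γ₁) = Proj τ(Γ₁)`, not cyclic, of order prime to `p`
  have hkermap : f.ker.map P.range.subtype = projectiveImage (τ.comp Γ₁.subtype) := by
    ext x
    constructor
    · rintro ⟨y, hy, rfl⟩
      obtain ⟨σ, rfl⟩ := hπsurj y
      rw [SetLike.mem_coe, MonoidHom.mem_ker, hfπ, hψker] at hy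
      exact ⟨⟨σ, hy⟩, rfl⟩
    · rintro ⟨σ, rfl⟩
      refine ⟨π σ, ?_, rfl⟩
      rw [SetLike.mem_coe, MonoidHom.mem_ker, hfπ, hψker]
      exact σ.2
  let e₁ : f.ker ≃* projectiveImage (τ.comp Γ₁.subtype) :=
    (f.ker.equivMapOfInjective P.range.subtype P.range.subtype_injective).trans
      (MulEquiv.subgroupCongr hkermap)
  haveI : Finite f.ker := Finite.of_equiv _ e₁.symm.toEquiv
  have hkercop : ¬ p ∣ Nat.card f.ker := by
    rw [Nat.card_congr e₁.toEquiv]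
    exact hcop
  have hkernc : ¬ IsCyclic f.ker := fun h ↦ by
    haveI := h
    exact hnc (isCyclic_of_surjective e₁.toMonoidHom e₁.surjective)
  haveI : Finite f.range := by rw [hfran]; infer_instance
  haveI : IsCyclic f.range := by rw [hfran]; infer_instance
  have h4 : 4 ≤ Nat.card f.range := by rw [hfran]; omega
  have hrancop : ¬ p ∣ Nat.card f.range := by rw [hfran]; exact hranψ
  exact false_of_not_isCyclic_ker f hkercop hrancop hkernc h4

end Galois

end Summit.Langlands.Langlands.Cruxes.LocallyReducibleParallel.Potaut

end
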